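import Summits.QuantumFields.YangMills.Theses.BoundedSkewnessRunning

/-!
# Route `BoundedSkewnessRunning` — the Assembly item (stmt-QuantumFields-19901)

`Assembly : UVSkewnessExtinction → SkewnessNonGeneration → SchemeCumulantScaling → WindowFromNontriviality → OffDiagonalReduction → ¬ YangMills`
is, verbatim and in the same order, the route's deciding theorem `BoundedSkewnessRunning.closes` (refutation form).  This file records the closure
BY NAME.  HONEST LABEL: the hypotheses (two cruxes, three supports) are OPEN items of the route; NOTHING about `YangMills` or its negation is
proved here — this is modus ponens bookkeeping only.

References: E. Seiler, LNP 159 (1982) / hep-th/0312015 [Seiler2003]; A. Jaffe, E. Witten (2000) [JaffeWitten2000].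
-/

namespace Summit.QuantumFields.YangMills.Theorems.BoundedSkewnessRunning

/-- **Assembly of route `BoundedSkewnessRunning`** (stmt-QuantumFields-19901): the route's deciding theorem, by name. -/
theorem assembly_proof : Summit.QuantumFields.YangMills.Theses.BoundedSkewnessRunning.Assembly :=
  fun h₁ h₂ h₃ h₄ h₅ => Summit.QuantumFields.YangMills.Theses.BoundedSkewnessRunning.closes h₁ h₂ h₃ h₄ h₅

end Summit.QuantumFields.YangMills.Theorems.BoundedSkewnessRunning
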